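import Summits.QuantumFields.YangMills.Theorems.BalabanUVNodesN06RgdDsLegAtPinsPhysRPar

/-!
# BalabanUVNodes ∕ N06 ([B9], `Dag.B9_main`) — R1 J-TWIN (KD‴ LEGS): THE RIGID D∕D⋆-SIDE LETTERS (3.151)∕(3.152) AT PHYSICAL PINS, SITE-TRANSPORTER-PARAMETRIC, ALONG A SUB-FAMILY `f : J → MemberY …` — the J-twin of
# ✓`…N06RgdDsLegAtPinsPhysRPar.rgdDs_rgdDd_of_pinsR_par`

Track A of `YM-PLAN.md` (cell `pub-ymgap`, HUMAN RULING D-0062), node **N06** = [Balaban1985BackgroundPropagators]; IR-N06-SECTION-2 road **R1** («J-twin of the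
producer cone», ★★★ director-ym №524 (3): authorised in principle, STAGED, sibling files only), `R1-JTWIN-SPEC.md` rule (R)′ (dag-n06-d, 2026-08-31): re-key EXACTLY
the section-tainted ∀-member rows along `f`, keep data ∕ pins ∕ laws ∕ section-free rows member-wide, tainted conclusions along `f` ((R).3′).
Seat `pub-ymgap-dag-n06-d` g30 — own-producer twins under «KD‴» (`…N06AtOpsYSectEStKnitSectDKDR`).

WHAT.  `rgdDs_rgdDd_of_pinsR_par_J` = the parent's theorem with `{J : Type} (f : J → MemberY d ℓ hd hL b₀ b₁ Mstar)` added after the `H` binder and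
* TAINTED ROWS OF THIS TWIN: `h49` — print's (3.49) majorant for `P` (⟸ (3.48) rows 15∕16 via `…N06Proj349AtPinsPhysRCPar`) and `h152` — the (3.152) identities
  `Ids3152 …` (in «KD‴» the local `hids`, fed by `FormSmall` of Theorem 3.12 from the Sect.-D layer L2, itself ⟸ row 17 `hΔAK` via `hpos12 ∕ hIdOfForm`), each re-keyed
  `∀ x : MemberY … ↦ ∀ j : J`, read at `f j`;
* LEFT member-wide: the symmetry law `hsymRT`, the S-blocks pin `hblkS`, the pins `hblk12 hblkY12 hblkW12`, the letter families ∕ pins ∕ laws ∕ instance binders, all x-free numerics ∕ rates ∕ thresholds;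
* conclusion: the x-free constants unchanged, the member clause `∀ j : J, … (f j) …` along `f`.
PROOF: the parent's text by generator (`mkJ.py` over the tree bytes): x-free ∃-witnesses; pointwise body `fun x ↦ fun j`, member reads `x ↦ f j`, `h49 x ↦ h49 j`,
`h152 x ↦ h152 j`; private helpers (if any) restated privately as in the parent; nothing re-derived.
HONEST FRAMING.  Bookkeeping over landed objects; every displayed row is a HYPOTHESIS; nothing of [B9] ∕ [4] asserted; COUNT-NEUTRAL (`--supports stmt-QuantumFields-27239
--as helper`); N06 NOT discharged; K1 NOT closed; under R1 the inner-corner question stays DISPLAYED at the K1 face ∕ NODE O join by (α5); nothing continuum ∕ OS ∕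
mass gap ∕ Clay.  0 `def`, 0 `sorry`.  NEW file; the parent untouched.  The member-wide parent is the instance `J := MemberY …`, `f := id`; ORPHAN by design until
`…N06AtOpsYSectEStKnitSectDKDR`ᴶ («KD‴»ᴶ) lands (honest).
[cite: Balaban1985BackgroundPropagators, (3.49) p.398, (3.151)–(3.153) p.426; Balaban1984PropagatorsII, Lemma 2.1 (2.60)–(2.61) p.234]
-/

noncomputable section

namespace Summit.QuantumFields.YangMills.BalabanUVNodes.N06RgdDsLegAtPinsPhysRParJ

open Literature.MathematicalPhysics.QuantumFieldTheory.Balaban1983to89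
open Literature.MathematicalPhysics.QuantumFieldTheory.Balaban1983to89.Node00
open Literature.MathematicalPhysics.QuantumFieldTheory.Balaban1983to89.B9Thm311ReadingCoords (IsSymmTr)
open Literature.MathematicalPhysics.QuantumFieldTheory.Balaban1983to89.Node00.OpsYSectDCoords (DvcoKH DvscoKH RcoK cR39_trBasis_pos)
open Literature.MathematicalPhysics.QuantumFieldTheory.Balaban1983to89.Node00.OpsYNablaBridge (slotCopyK dirSliceK cf_mul_etaS_of_hcfk)
open Literature.MathematicalPhysics.QuantumFieldTheory.Balaban1983to89.B9Thm34Ext (toB6)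
open Literature.MathematicalPhysics.QuantumFieldTheory.Balaban1983to89.B11SectG (BlockNorm HasMaj RowSum)
open Literature.MathematicalPhysics.QuantumFieldTheory.Balaban1983to89.B9SectDL2Decay (BlockBd)
open Literature.MathematicalPhysics.QuantumFieldTheory.Balaban1983to89.B9Thm37Glue (IsTransposePair isTransposePair_one)
open Literature.MathematicalPhysics.QuantumFieldTheory.Balaban1983to89.B9Thm37GlueTorusCov (isTransposePair_smul)
open Literature.MathematicalPhysics.QuantumFieldTheory.Balaban1983to89.B9Thm312Whole (GeoOK)
open Literature.MathematicalPhysics.QuantumFieldTheory.Balaban1983to89.B9Thm37Whole (Sizes StaticOK Local342)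
open Literature.MathematicalPhysics.QuantumFieldTheory.Balaban1983to89.B9RWSums346SecondDiffGp (DirOps37 DirTranspose37 L2SecondLegs37)
open Literature.MathematicalPhysics.QuantumFieldTheory.Balaban1983to89.B9Thm37WholeDir (DirLetters37 DirSupSq37 Identities₂)
open Literature.MathematicalPhysics.QuantumFieldTheory.Balaban1983to89.B9RWSums346SecondDiffGpLeftPairM (l2line5_left_pairM)
open Literature.MathematicalPhysics.QuantumFieldTheory.Balaban1983to89.B6RandomWalk (c1_nonneg)
open Literature.MathematicalPhysics.QuantumFieldTheory.Balaban1983to89.B9RWSumsDefinitePins (PinPrims)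
open Literature.MathematicalPhysics.QuantumFieldTheory.Balaban1983to89.B9RWSumsDefinitePinsPair (PairPrims)
open Literature.MathematicalPhysics.QuantumFieldTheory.Balaban1983to89.B9RWSums347DefiniteFaces (exp261 lemma21Pack_geo9Y)
open Literature.MathematicalPhysics.QuantumFieldTheory.Balaban1983to89.B9PinMembersKLevelV1 (MemberY geo9Y bg9Y)
open Literature.MathematicalPhysics.QuantumFieldTheory.Balaban1983to89.B9BackgroundsKLevelV1R (RegFamY bg9YR)
open Literature.MathematicalPhysics.QuantumFieldTheory.Balaban1983to89.B9GeoLemma21KLevelV1 (geo9Y_len_pos geo9Y_dist_triangle geo9Y_dist_comm rowSum261_geo9Y)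
open Literature.MathematicalPhysics.QuantumFieldTheory.Balaban1983to89.B9GeoNormsKLevelV1 (geo9K geo9K_dist_nonneg)
open Literature.MathematicalPhysics.QuantumFieldTheory.Balaban1983to89.B7Prop2SpecialUnitary (specialUnitaryUnits)
open Literature.MathematicalPhysics.QuantumFieldTheory.Balaban1983to89.B9CoReadingCoords (XBK blkBK coordOpK cdsBₗ DscoK)
open Literature.MathematicalPhysics.QuantumFieldTheory.Balaban1983to89.B9CoReadingCoordsH (XHK)
open Literature.MathematicalPhysics.QuantumFieldTheory.Balaban1983to89.B9CoReadingCoordsS (XSK GcoS blkSK sIK)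
open Literature.MathematicalPhysics.QuantumFieldTheory.Balaban1983to89.B9CoReadingCoordsTranspose (TrIdx trBasis isTransposePair_coordOpK_of_isSymmTr
  trBasis_repr_eq_trace)
open Literature.MathematicalPhysics.QuantumFieldTheory.Balaban1983to89.B9Thm39ReadingCoords (cR39 cR39_nonneg)
open Literature.MathematicalPhysics.QuantumFieldTheory.Balaban1983to89.B9Ineq349SiteComposite (cdsSL)
open Literature.MathematicalPhysics.QuantumFieldTheory.Balaban1983to89.B9PerturbationMajorantAlgebra (Proj349Maj)
open Literature.MathematicalPhysics.QuantumFieldTheory.Balaban1983to89.B9PerturbationMajorantsAtLetters (PcoK rcoK_eq)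
open Literature.MathematicalPhysics.QuantumFieldTheory.Balaban1983to89.B9PerturbationMajorantsAtLettersPhys (rcoK_GpPhysY)
open Literature.MathematicalPhysics.QuantumFieldTheory.Balaban1983to89.B9Thm313WholeRgdFrom3152 (Ids3152)
open Literature.MathematicalPhysics.QuantumFieldTheory.Balaban1983to89.B9Thm313WholeRgdSecondFrom3152 (blockBd_slotWord rgdE_of_ids3152)
open Literature.MathematicalPhysics.QuantumFieldTheory.Balaban1983to89.B9DivGradStarKinematicsAtPins (blockBd_slotCopyK blockBd_dirSliceK blockBd_sliceProjK_any
  GcoS_DvscoKH_DscoK_eq GcoS_DvscoKH_DdsB_eq)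
open Literature.MathematicalPhysics.QuantumFieldTheory.Balaban1983to89.B9GradViaDivLettersAtPins (rJ sliceProjK)
open Literature.MathematicalPhysics.QuantumFieldTheory.Balaban1983to89.B6GlobalChartV1 (blkV1)
open Literature.MathematicalPhysics.QuantumFieldTheory.Balaban1983to89.B6Ineq2142KLevelV1 (β lvl)
open Literature.MathematicalPhysics.QuantumFieldTheory.Balaban1983to89.B6Geom246MultiLevelTorus (geomT)
open scoped Matrix.Norms.L2Operator

variable {N : ℕ} [NeZero N]
variable {d ℓ : ℕ} {hd : 1 ≤ d + 1} {hL : Odd (ℓ + 1) ∧ 1 < ℓ + 1} {b₀ b₁ : ℝ} {Mstar : ℕ}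
variable [∀ x : MemberY d ℓ hd hL b₀ b₁ Mstar, Fintype (geo9Y x).Site] [∀ x : MemberY d ℓ hd hL b₀ b₁ Mstar, DecidableEq (geo9Y x).Site]

/-- ★★ **`hLL2`'s LAST FIELDS `rgdDs` AND `rgdDd μ₀` AT THE PINS, MEMBER-UNIFORMLY, AT A SITE-TRANSPORTER PARAMETER `parT`** (module docstring): the
parent `N06RgdDsLegAtPinsPhysR.rgdDs_rgdDd_of_pinsR` with `parSymY ↦ parT` in the pins `hRco12` (R = `RcoK … parT (GpPhysY parT)`) and `h49` ((3.49) at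
`PcoK … parT (GpY parT)`), the trace symmetry of `R(U; parT, G′(parT))` DISPLAYED as the guarded law `hsymRT` (rows-20–21 regime `M₁ ≤ M`, `M·α₀ ≤ a₁`,
(3.35)); all other inputs and the conclusion verbatim: ∃ `Mc ≥ M₁`, `B₄ ≥ B₄₀` with, above `Mc` and in both regimes, ‖1_{Δ(y)}R∇\*_UG₁∇\*_Uλ‖₂ ≦
B₄e^{−δ₃d(y,y′)}‖λ‖₂ and, for every `μ₀`, ‖1_{Δ(y)}R∇\*_UG₁∇\*_{U,μ₀}λ‖₂ ≦ B₄e^{−δ₃d(y,y′)}‖λ‖₂.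
[cite: Balaban1985BackgroundPropagators, Thm 3.13 p.426, (3.152)–(3.153) p.426, Thm 3.1 (3.46) p.398 + (3.39) p.397, (3.49) p.399, (3.19) p.393, (3.24)–(3.25) p.394, (3.35) p.396; Balaban1985Averaging, Prop. 2 p.26; Balaban1984PropagatorsII, (2.45)–(2.46) p.231, (2.51)–(2.56) pp.232–233, Lemma 2.1 (2.59)–(2.61) pp.233–234] -/
theorem rgdDs_rgdDd_of_pinsR_par_J (parT : ∀ i : B6KLevelCensusIndexV1.KIdx d ℓ hd hL b₀ b₁, Node00.SiteParY (Matrix (Fin N) (Fin N) ℂ) i)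
    {R₁ R₂ : RegFamY d ℓ hd hL b₀ b₁ Mstar (Matrix (Fin N) (Fin N) ℂ)}
    (H : MemberY d ℓ hd hL b₀ b₁ Mstar → Prop) {J : Type} (f : J → MemberY d ℓ hd hL b₀ b₁ Mstar)
    (bI : ∀ x : MemberY d ℓ hd hL b₀ b₁ Mstar, FBondY x.toKIdx → IBondY x.toKIdx)
    (hβ1 : ∀ (x : MemberY d ℓ hd hL b₀ b₁ Mstar) (f : FBondY x.toKIdx),
      (geomT x.toKIdx.D).dist (β x.toKIdx.hN x.toKIdx.D x.toKIdx.hk (bI x f)) (blkV1 x.toKIdx.hN x.toKIdx.D f) ≤ 1)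
    -- the Sect.-D letter record of rows 20–21 and its pins
    (𝔬12 : ∀ x : MemberY d ℓ hd hL b₀ b₁ Mstar, B9Thm312Whole.Ops (geo9Y x) (bg9YR (Matrix (Fin N) (Fin N) ℂ) (specialUnitaryUnits (Fin N)) R₁ R₂ x)
      (XBK (TrIdx N) x.toKIdx) (XBK (TrIdx N) x.toKIdx) (XHK (TrIdx N) x.toKIdx) (XSK (TrIdx N) x.toKIdx))
    (hblk12 : ∀ x : MemberY d ℓ hd hL b₀ b₁ Mstar, (𝔬12 x).blk = blkBK x.toKIdx (bI x))
    (hblkY12 : ∀ x : MemberY d ℓ hd hL b₀ b₁ Mstar, (𝔬12 x).blkY = blkBK x.toKIdx (bI x))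
    (hblkW12 : ∀ x : MemberY d ℓ hd hL b₀ b₁ Mstar, (𝔬12 x).blkW = blkSK x.toKIdx (sIK x.toKIdx (bI x)))
    (hDvco12 : ∀ (x : MemberY d ℓ hd hL b₀ b₁ Mstar) (U : (bg9YR (Matrix (Fin N) (Fin N) ℂ) (specialUnitaryUnits (Fin N)) R₁ R₂ x).Cfg),
      (𝔬12 x).Dv U = DvcoKH x.toKIdx (trBasis N) (bg9YR (Matrix (Fin N) (Fin N) ℂ) (specialUnitaryUnits (Fin N)) R₁ R₂ x) (fun U => U) U)
    (hDvsco12 : ∀ (x : MemberY d ℓ hd hL b₀ b₁ Mstar) (U : (bg9YR (Matrix (Fin N) (Fin N) ℂ) (specialUnitaryUnits (Fin N)) R₁ R₂ x).Cfg),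
      (𝔬12 x).Dvstar U = DvscoKH x.toKIdx (trBasis N) (bg9YR (Matrix (Fin N) (Fin N) ℂ) (specialUnitaryUnits (Fin N)) R₁ R₂ x) (fun U => U) U)
    (hDsco12 : ∀ (x : MemberY d ℓ hd hL b₀ b₁ Mstar) (U : (bg9YR (Matrix (Fin N) (Fin N) ℂ) (specialUnitaryUnits (Fin N)) R₁ R₂ x).Cfg),
      (𝔬12 x).Dstar U = DscoK x.toKIdx (trBasis N) (bg9YR (Matrix (Fin N) (Fin N) ℂ) (specialUnitaryUnits (Fin N)) R₁ R₂ x) (fun U => U) U)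
    (hRco12 : ∀ (x : MemberY d ℓ hd hL b₀ b₁ Mstar) (U : (bg9YR (Matrix (Fin N) (Fin N) ℂ) (specialUnitaryUnits (Fin N)) R₁ R₂ x).Cfg),
      (𝔬12 x).R U = RcoK x.toKIdx (trBasis N) (bg9YR (Matrix (Fin N) (Fin N) ℂ) (specialUnitaryUnits (Fin N)) R₁ R₂ x) (fun U => U) (parT x.toKIdx) (GpPhysY x.toKIdx (parT x.toKIdx)) U)
    -- the A-side direction letters ∇*_{U,μ₀} on bond functions (the certificate's `(𝔡A x).Dsd`, pin `h𝔡As`)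
    (DdsA : ∀ x : MemberY d ℓ hd hL b₀ b₁ Mstar, (bg9YR (Matrix (Fin N) (Fin N) ℂ) (specialUnitaryUnits (Fin N)) R₁ R₂ x).Cfg → Fin (d + 1) →
      Module.End ℝ (XBK (TrIdx N) x.toKIdx → ℝ))
    (hDdsA : ∀ (x : MemberY d ℓ hd hL b₀ b₁ Mstar) (U : (bg9YR (Matrix (Fin N) (Fin N) ℂ) (specialUnitaryUnits (Fin N)) R₁ R₂ x).Cfg),
      DdsA x U = fun μ => coordOpK (trBasis N) (fun _ : Fin (d + 1) => cdsBₗ x.toKIdx U μ))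
    -- rows 18's walk records at the site pins (UT: `opsWalkY ∕ dirOpsWalkY ∕ dirLettersWalkY`, pins by `rfl`), the G′ model `O`
    {ι : MemberY d ℓ hd hL b₀ b₁ Mstar → Type} [∀ x, Fintype (ι x)]
    (𝔬 : ∀ x : MemberY d ℓ hd hL b₀ b₁ Mstar, B9Thm37Whole.Ops (geo9Y x) (bg9YR (Matrix (Fin N) (Fin N) ℂ) (specialUnitaryUnits (Fin N)) R₁ R₂ x)
      (XSK (TrIdx N) x.toKIdx) (XSK (TrIdx N) x.toKIdx) (ι x))
    (𝔡 : ∀ x : MemberY d ℓ hd hL b₀ b₁ Mstar, DirOps37 (𝔬 x) (Fin (d + 1))) (𝔩 : ∀ x : MemberY d ℓ hd hL b₀ b₁ Mstar, DirLetters37 (𝔬 x) (Fin (d + 1)))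
    (O : ∀ x : MemberY d ℓ hd hL b₀ b₁ Mstar, SiteOpY (Matrix (Fin N) (Fin N) ℂ) x.toKIdx)
    (hblkS : ∀ x : MemberY d ℓ hd hL b₀ b₁ Mstar, (𝔬 x).blk = blkSK x.toKIdx (sIK x.toKIdx (bI x)))
    (hGpS : ∀ (x : MemberY d ℓ hd hL b₀ b₁ Mstar) (U : (bg9YR (Matrix (Fin N) (Fin N) ℂ) (specialUnitaryUnits (Fin N)) R₁ R₂ x).Cfg),
      (𝔬 x).Gp U = GcoS x.toKIdx (trBasis N) (bg9YR (Matrix (Fin N) (Fin N) ℂ) (specialUnitaryUnits (Fin N)) R₁ R₂ x) (fun U => U) (O x) U)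
    (h𝔡s : ∀ (x : MemberY d ℓ hd hL b₀ b₁ Mstar) (U : (bg9YR (Matrix (Fin N) (Fin N) ℂ) (specialUnitaryUnits (Fin N)) R₁ R₂ x).Cfg),
      (𝔡 x).Dsd U = fun μ => (etaS x.toKIdx)⁻¹ • coordOpK (trBasis N) (fun _ : Fin (d + 1) => (cdsSL x.toKIdx U μ).restrictScalars ℝ))
    (κS : MemberY d ℓ hd hL b₀ b₁ Mstar → Sizes) (S3 : ∀ x : MemberY d ℓ hd hL b₀ b₁ Mstar, ι x → Finset (geo9Y x).Site)
    (p : PinPrims) (hp : p.OK) (p3 : PairPrims) (hp3 : p3.OK) {c35 : ℝ}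
    (hst : ∀ x, StaticOK (𝔬 x) p.ρ p.Nc p.N' p.Cℓ (κS x)) (hκ : ∀ x, (κS x).Bounded p.Kc p.θ₀ p.Cℓ (geo9Y x).M)
    (hcnt3 : ∀ x (a : (geo9Y x).Site), (∑ c, if a ∈ S3 x c then (1 : ℝ) else 0) ≤ p3.N3)
    (h36 : ∀ x, p.M₁ ≤ (geo9Y x).M → ∀ α₀ : ℝ, 0 < α₀ → c35 * (geo9Y x).M * α₀ ≤ p.a₁ →
      ∀ U : (bg9YR (Matrix (Fin N) (Fin N) ℂ) (specialUnitaryUnits (Fin N)) R₁ R₂ x).Cfg, (bg9YR (Matrix (Fin N) (Fin N) ℂ) (specialUnitaryUnits (Fin N)) R₁ R₂ x).Reg335 c35 α₀ U →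
        Local342 (𝔬 x) 1 (H x) p.B₀ p.δ₀ U ∧ DirSupSq37 (𝔬 x) (𝔡 x) 1 (H x) U ∧ Identities₂ (𝔬 x) (𝔡 x) (𝔩 x) 1 (H x) U)
    (hL5 : ∀ x, p.M₁ ≤ (geo9Y x).M → ∀ α₀ : ℝ, 0 < α₀ → c35 * (geo9Y x).M * α₀ ≤ p.a₁ →
      ∀ U : (bg9YR (Matrix (Fin N) (Fin N) ℂ) (specialUnitaryUnits (Fin N)) R₁ R₂ x).Cfg, (bg9YR (Matrix (Fin N) (Fin N) ℂ) (specialUnitaryUnits (Fin N)) R₁ R₂ x).Reg335 c35 α₀ U →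
        L2SecondLegs37 (𝔬 x) (𝔡 x) 1 (H x) (S3 x) p3.B3 p.δ₀ U ∧ (∀ q', IsTransposePair ((𝔬 x).Gsq U q') ((𝔬 x).Gsq U q')) ∧
          (∀ q' μ, IsTransposePair ((𝔩 x).Pt U q' μ) ((𝔩 x).P U q' μ)) ∧ (∀ q', IsTransposePair ((𝔬 x).Ct U q') ((𝔬 x).Cop U q')) ∧
          DirTranspose37 (𝔬 x) (𝔡 x) U)
    -- the rows-20–21 numerics and displayed (3.49), (3.152)
    {M₁ a₁ CP δP σS δ₃ : ℝ} (B₄₀ : ℝ) (hCP : 0 ≤ CP) (hσS : 0 < σS) (hδ₃0 : 0 ≤ δ₃)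
    (hδ₃5 : δ₃ ≤ (1 - 2 * p.αF) * ((1 - 2 * p.α) * p.δ₀)) (hδ₃P : δ₃ + σS ≤ δP)
    (h49 : ∀ j : J, M₁ ≤ (geo9Y (f j)).M → ∀ α₀ : ℝ, 0 < α₀ → (geo9Y (f j)).M * α₀ ≤ a₁ →
      ∀ U : (bg9YR (Matrix (Fin N) (Fin N) ℂ) (specialUnitaryUnits (Fin N)) R₁ R₂ (f j)).Cfg, (bg9YR (Matrix (Fin N) (Fin N) ℂ) (specialUnitaryUnits (Fin N)) R₁ R₂ (f j)).Reg335 c35 α₀ U →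
        Proj349Maj (g := geo9Y (f j)) (blkSK (f j).toKIdx (sIK (f j).toKIdx (bI (f j)))) (blkBK (f j).toKIdx (bI (f j)))
          (PcoK (f j).toKIdx (trBasis N) (bg9YR (Matrix (Fin N) (Fin N) ℂ) (specialUnitaryUnits (Fin N)) R₁ R₂ (f j)) (fun U => U) (parT (f j).toKIdx) (GpY (f j).toKIdx (parT (f j).toKIdx)) U)
          (DvcoKH (f j).toKIdx (trBasis N) (bg9YR (Matrix (Fin N) (Fin N) ℂ) (specialUnitaryUnits (Fin N)) R₁ R₂ (f j)) (fun U => U) U)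
          (DvscoKH (f j).toKIdx (trBasis N) (bg9YR (Matrix (Fin N) (Fin N) ℂ) (specialUnitaryUnits (Fin N)) R₁ R₂ (f j)) (fun U => U) U) 1 (H (f j)) CP δP)
    (h152 : ∀ j : J, M₁ ≤ (geo9Y (f j)).M → ∀ α₀ : ℝ, 0 < α₀ → (geo9Y (f j)).M * α₀ ≤ a₁ →
      ∀ U : (bg9YR (Matrix (Fin N) (Fin N) ℂ) (specialUnitaryUnits (Fin N)) R₁ R₂ (f j)).Cfg, (bg9YR (Matrix (Fin N) (Fin N) ℂ) (specialUnitaryUnits (Fin N)) R₁ R₂ (f j)).Reg335 c35 α₀ U →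
        (bg9YR (Matrix (Fin N) (Fin N) ℂ) (specialUnitaryUnits (Fin N)) R₁ R₂ (f j)).Reg336 c35 α₀ U →
          Ids3152 (𝔬12 (f j)) (fun U => GcoS (f j).toKIdx (trBasis N) (bg9YR (Matrix (Fin N) (Fin N) ℂ) (specialUnitaryUnits (Fin N)) R₁ R₂ (f j)) (fun U => U) (O (f j)) U) U)
    -- [CASCADE-K «K3-D»] the transporter LAW (parent: `isTransposePair_RcoK` at `parSymY`): `R(U; parT, G′(parT))` trace-symmetric on the rows-20–21 regime
    (hsymRT : ∀ x : MemberY d ℓ hd hL b₀ b₁ Mstar, M₁ ≤ (geo9Y x).M → ∀ α₀ : ℝ, 0 < α₀ → (geo9Y x).M * α₀ ≤ a₁ →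
      ∀ U : (bg9YR (Matrix (Fin N) (Fin N) ℂ) (specialUnitaryUnits (Fin N)) R₁ R₂ x).Cfg, (bg9YR (Matrix (Fin N) (Fin N) ℂ) (specialUnitaryUnits (Fin N)) R₁ R₂ x).Reg335 c35 α₀ U →
        IsSymmTr (fun _ => (1 : ℝ)) (RY x.toKIdx (parT x.toKIdx) (GpY x.toKIdx (parT x.toKIdx)) U)) :
    ∃ (Mc B₄ : ℝ), M₁ ≤ Mc ∧ B₄₀ ≤ B₄ ∧
      ∀ j : J, Mc ≤ (geo9Y (f j)).M → ∀ α₀ : ℝ, 0 < α₀ → (geo9Y (f j)).M * α₀ ≤ a₁ → c35 * (geo9Y (f j)).M * α₀ ≤ p.a₁ →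
        ∀ U : (bg9YR (Matrix (Fin N) (Fin N) ℂ) (specialUnitaryUnits (Fin N)) R₁ R₂ (f j)).Cfg, (bg9YR (Matrix (Fin N) (Fin N) ℂ) (specialUnitaryUnits (Fin N)) R₁ R₂ (f j)).Reg335 c35 α₀ U →
          (bg9YR (Matrix (Fin N) (Fin N) ℂ) (specialUnitaryUnits (Fin N)) R₁ R₂ (f j)).Reg336 c35 α₀ U →
            BlockBd (g := toB6 (geo9Y (f j)) 1 (H (f j))) (𝔬12 (f j)).blkY (𝔬12 (f j)).blkW ((𝔬12 (f j)).R U ∘ₗ (𝔬12 (f j)).Dvstar U ∘ₗ (𝔬12 (f j)).G1 U ∘ₗ (𝔬12 (f j)).Dstar U)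
                (fun (y y' : (geo9Y (f j)).Site) => B₄ * Real.exp (-(δ₃ * (geo9Y (f j)).dist y y'))) ∧
              ∀ μ₀ : Fin (d + 1), BlockBd (g := toB6 (geo9Y (f j)) 1 (H (f j))) (𝔬12 (f j)).blk (𝔬12 (f j)).blkW
                ((𝔬12 (f j)).R U ∘ₗ (𝔬12 (f j)).Dvstar U ∘ₗ (𝔬12 (f j)).G1 U ∘ₗ DdsA (f j) U μ₀)
                (fun (y y' : (geo9Y (f j)).Site) => B₄ * Real.exp (-(δ₃ * (geo9Y (f j)).dist y y'))) := by
  classical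
  have hN0 : 0 < N := Nat.pos_of_ne_zero (NeZero.ne N)
  have hc0 : 0 < cR39 (trBasis N) := cR39_trBasis_pos hN0
  have hϱ : 0 ≤ (cR39 (trBasis N))⁻¹ := inv_nonneg.mpr hc0.le
  obtain ⟨hN3, hB3, -⟩ := hp3
  have h2α : 0 ≤ 1 - 2 * p.α := by linarith only [hp.α_lt]
  have hδ5 : 0 ≤ (1 - 2 * p.α) * p.δ₀ := mul_nonneg h2α hp.δ₀_pos.le
  -- rows 18's member facts (Lemma 2.1 of [4] at (δ₀, α); `Facts347` at ((1−2α)δ₀, α_F)) above ONE threshold, and [4] (2.61) at the margin σS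
  obtain ⟨Mth, h261, hfacts, -⟩ := lemma21Pack_geo9Y (d := d) (ℓ := ℓ) (hd := hd) (hL := hL) (b₀ := b₀) (b₁ := b₁) (Mstar := Mstar) H hp.α_pos hp.α_lt
    hp.δ₀_pos hp.αF_pos (by linarith only [hp.αF_lt])
  obtain ⟨ML, c₁, hrow⟩ := rowSum261_geo9Y (d := d) (ℓ := ℓ) (hd := hd) (hL := hL) (b₀ := b₀) (b₁ := b₁) (Mstar := Mstar) σS hσS
  set c : ℝ := max c₁ 0 with hcdef
  have hc : 0 ≤ c := le_max_right _ _
  set L₀ : ℝ := ((ℓ + 1 : ℕ) : ℝ) with hL₀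
  -- the walk's largeness threshold of `l2line5_left_pairM`
  set Mbig : ℝ := 2 * p.N' * (p.B₀ * Real.exp (p.δ₀ * p.ρ) * p.θ₀) * Real.sqrt L₀ * B6.c1 (exp261 (@geo9Y d ℓ hd hL b₀ b₁ Mstar) p.δ₀ p.α) p.δ₀ p.α with hMbigdef
  -- the constants: second-order line C_A, kinematic letters C_E (direction slice), d+1 (slot copy), 1 (slice projection); c_fη = 1
  set CA : ℝ := 2 * (p3.N3 * p3.B3) with hCAdef
  have hCA : 0 ≤ CA := by positivity
  set CE : ℝ := ((d : ℝ) + 1) * Real.exp ((δ₃ + σS) * rJ d ℓ) with hCEdef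
  have hCE : 0 ≤ CE := by positivity
  set B₅ : ℝ := |(1 : ℝ)| * (((d + 1 : ℕ) : ℝ) * (1 * ((((d + 1 : ℕ) : ℝ)) * (((d : ℝ) + 1) * (CA * CE * c) * c)) * c)) with hB₅def
  have hB₅ : 0 ≤ B₅ := by positivity
  set B₄ : ℝ := max B₄₀ ((cR39 (trBasis N))⁻¹ * (B₅ * (1 + CP * c))) with hB₄def
  have hB₄b : (cR39 (trBasis N))⁻¹ * (B₅ * (1 + CP * c)) ≤ B₄ := le_max_right _ _
  refine ⟨max (max M₁ p.M₁) (max Mth (max ML Mbig)), B₄, (le_max_left _ _).trans (le_max_left _ _), le_max_left _ _,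
    fun j hM α₀ hα ha hap U hU hU' => ?_⟩
  have hM1x : M₁ ≤ (geo9Y (f j)).M := ((le_max_left _ _).trans (le_max_left _ _)).trans hM
  have hpM1x : p.M₁ ≤ (geo9Y (f j)).M := ((le_max_right _ _).trans (le_max_left _ _)).trans hM
  have hMthx : Mth ≤ (geo9Y (f j)).M := ((le_max_left _ _).trans (le_max_right _ _)).trans hM
  have hMLx : ML ≤ (geo9Y (f j)).M := (((le_max_left _ _).trans (le_max_right _ _)).trans (le_max_right _ _)).trans hM
  have hMbigx : Mbig ≤ (geo9Y (f j)).M := (((le_max_right _ _).trans (le_max_right _ _)).trans (le_max_right _ _)).trans hM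
  have hMpos : 0 < (geo9Y (f j)).M := lt_of_lt_of_le hp.M₁_pos hpM1x
  have hG : GeoOK (geo9Y (f j)) := ⟨geo9Y_dist_triangle (f j), geo9Y_dist_comm (f j), geo9K_dist_nonneg (f j).toKIdx, geo9Y_len_pos (f j)⟩
  have hrowx : RowSum (toB6 (geo9Y (f j)) 1 (H (f j))) σS c := fun y => (hrow (f j) hMLx y).trans (le_max_left _ _)
  letI : Fintype (geo9K (f j).toKIdx).Site := (inferInstance : Fintype (geo9Y (f j)).Site)
  -- rows 18's structure and second-order bundle at this member
  obtain ⟨hloc, hDsq, hids⟩ := h36 (f j) hpM1x α₀ hα hap U hU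
  obtain ⟨hL2, hGsqT, hPt, hCt, hDT⟩ := hL5 (f j) hpM1x α₀ hα hap U hU
  -- ONE per-pair second-order line of G′ (rows 18, `l2line5_left_pairM`): ‖1_Δ G′∇*_{U,μ}∇*_{U,ν}‖ ≤ 2N₃B₃ e^{−(1−2α_F)(1−2α)δ₀ d}
  have hpair : ∀ μ ν : Fin (d + 1), BlockBd (g := toB6 (geo9Y (f j)) 1 (H (f j))) (𝔬 (f j)).blk (𝔬 (f j)).blk ((𝔬 (f j)).Gp U ∘ₗ ((𝔡 (f j)).Dsd U μ ∘ₗ (𝔡 (f j)).Dsd U ν))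
      (fun (a b : (geo9Y (f j)).Site) => 2 * (p3.N3 * p3.B3) * Real.exp (-((1 - 2 * p.αF) * ((1 - 2 * p.α) * p.δ₀) * (geo9Y (f j)).dist a b))) :=
    fun μ ν => l2line5_left_pairM (𝔬 (f j)) (𝔡 (f j)) (𝔩 (f j)) 1 (H (f j)) (exp261 (@geo9Y d ℓ hd hL b₀ b₁ Mstar) ((1 - 2 * p.α) * p.δ₀) (1 - p.αF))
      (exp261 (@geo9Y d ℓ hd hL b₀ b₁ Mstar) p.δ₀ p.α) ((1 - 2 * p.α) * p.δ₀) p.αF L₀ p.δ₀ p.α p.ρ p.Nc p.N' p.Cℓ p3.N3 p3.B3 p.B₀ p.Kc p.θ₀ (κS (f j)) (S3 (f j)) U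
      hp.N'_nn hN3 hB3 hp.B₀_pos.le (le_trans zero_le_one hp.one_le_Cℓ) hp.δ₀_pos.le hp.α_pos.le (mul_nonneg hp.αF_pos.le hδ5)
      (by nlinarith only [hp.αF_lt, hδ5]) le_rfl (hst (f j)) (hκ (f j)) hMpos hMbigx (hcnt3 (f j)) (h261 (f j) hMthx) (hfacts (f j) hMthx) hids hloc hDsq hL2 hDT hGsqT hPt hCt μ ν
  -- the same at the models: G′ = GcoS … O, ∇*_{U,μ} = η⁻¹ • coordOpK (cdsSL μ), blocks blkSK (sIK bI)
  have hA : ∀ μ ν : Fin (d + 1), BlockBd (g := toB6 (geo9Y (f j)) 1 (H (f j))) (blkSK (f j).toKIdx (sIK (f j).toKIdx (bI (f j)))) (blkSK (f j).toKIdx (sIK (f j).toKIdx (bI (f j))))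
      (GcoS (f j).toKIdx (trBasis N) (bg9YR (Matrix (Fin N) (Fin N) ℂ) (specialUnitaryUnits (Fin N)) R₁ R₂ (f j)) (fun U => U) (O (f j)) U ∘ₗ
        ((etaS (f j).toKIdx)⁻¹ • coordOpK (trBasis N) (fun _ : Fin (d + 1) => (cdsSL (f j).toKIdx U μ).restrictScalars ℝ)) ∘ₗ
        ((etaS (f j).toKIdx)⁻¹ • coordOpK (trBasis N) (fun _ : Fin (d + 1) => (cdsSL (f j).toKIdx U ν).restrictScalars ℝ)))
      (fun (a b : (geo9Y (f j)).Site) => CA * Real.exp (-((1 - 2 * p.αF) * ((1 - 2 * p.α) * p.δ₀) * (geo9Y (f j)).dist a b))) := by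
    intro μ ν
    have h := hpair μ ν
    rw [hblkS (f j), hGpS (f j) U, h𝔡s (f j) U] at h
    exact h
  -- the kinematic letters at the rate δ₃ + σS
  have hE : ∀ μ ν : Fin (d + 1), BlockBd (g := toB6 (geo9Y (f j)) 1 (H (f j))) (blkBK (f j).toKIdx (bI (f j))) (blkSK (f j).toKIdx (sIK (f j).toKIdx (bI (f j))))
      (dirSliceK (κ := TrIdx N) (f j).toKIdx μ ν) (fun (a b : (geo9Y (f j)).Site) => CE * Real.exp (-((δ₃ + σS) * (geo9Y (f j)).dist a b))) :=
    fun μ ν => blockBd_dirSliceK (f j).toKIdx (hβ1 (f j)) (by linarith only [hδ₃0, hσS]) 1 (H (f j)) μ ν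
  have hCp : ∀ μ : Fin (d + 1), BlockBd (g := toB6 (geo9Y (f j)) 1 (H (f j))) (blkSK (f j).toKIdx (sIK (f j).toKIdx (bI (f j)))) (blkSK (f j).toKIdx (sIK (f j).toKIdx (bI (f j))))
      (slotCopyK (κ := TrIdx N) μ) (fun (a b : (geo9Y (f j)).Site) => ((d : ℝ) + 1) * Real.exp (-((δ₃ + σS) * (geo9Y (f j)).dist a b))) :=
    fun μ => blockBd_slotCopyK (f j).toKIdx 1 (H (f j)) (sIK (f j).toKIdx (bI (f j))) μ
  have hPr : ∀ ν : Fin (d + 1), BlockBd (g := toB6 (geo9Y (f j)) 1 (H (f j))) (blkSK (f j).toKIdx (sIK (f j).toKIdx (bI (f j)))) (blkSK (f j).toKIdx (sIK (f j).toKIdx (bI (f j))))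
      (sliceProjK (κ := TrIdx N) ν) (fun (a b : (geo9Y (f j)).Site) => (1 : ℝ) * Real.exp (-((δ₃ + σS) * (geo9Y (f j)).dist a b))) :=
    fun ν => blockBd_sliceProjK_any (f j).toKIdx 1 (H (f j)) (blkSK (f j).toKIdx (sIK (f j).toKIdx (bI (f j)))) ν
  have hcf : (f j).toKIdx.cf * etaS (f j).toKIdx = 1 := cf_mul_etaS_of_hcfk (f j).toKIdx (f j).hcfk
  have hcard : (Fintype.card (Fin (d + 1)) : ℝ) = ((d + 1 : ℕ) : ℝ) := by rw [Fintype.card_fin]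
  have hd1 : ((d + 1 : ℕ) : ℝ) = (d : ℝ) + 1 := by push_cast; ring
  -- (3.49) read for (𝔬12 (f j))'s letters, R = ϱ(I − P), Pᵀ = P
  have h49p : Proj349Maj (g := geo9Y (f j)) (𝔬12 (f j)).blkW (𝔬12 (f j)).blk
      (PcoK (f j).toKIdx (trBasis N) (bg9YR (Matrix (Fin N) (Fin N) ℂ) (specialUnitaryUnits (Fin N)) R₁ R₂ (f j)) (fun U => U) (parT (f j).toKIdx) (GpY (f j).toKIdx (parT (f j).toKIdx)) U)
      ((𝔬12 (f j)).Dv U) ((𝔬12 (f j)).Dvstar U) 1 (H (f j)) CP δP := by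
    rw [hblkW12 (f j), hblk12 (f j), hDvco12 (f j) U, hDvsco12 (f j) U]; exact h49 j hM1x α₀ hα ha U hU
  have hR : (𝔬12 (f j)).R U = (cR39 (trBasis N))⁻¹ • (LinearMap.id -
      PcoK (f j).toKIdx (trBasis N) (bg9YR (Matrix (Fin N) (Fin N) ℂ) (specialUnitaryUnits (Fin N)) R₁ R₂ (f j)) (fun U => U) (parT (f j).toKIdx) (GpY (f j).toKIdx (parT (f j).toKIdx)) U) := by
    rw [hRco12 (f j) U, rcoK_GpPhysY, rcoK_eq]
  -- the displayed law `hsymRT` in place of the parent's `isTransposePair_RcoK` (its proof, at `parT`)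
  have hRsym : IsTransposePair
      (RcoK (f j).toKIdx (trBasis N) (bg9YR (Matrix (Fin N) (Fin N) ℂ) (specialUnitaryUnits (Fin N)) R₁ R₂ (f j)) (fun U => U) (parT (f j).toKIdx) (GpY (f j).toKIdx (parT (f j).toKIdx)) U)
      (RcoK (f j).toKIdx (trBasis N) (bg9YR (Matrix (Fin N) (Fin N) ℂ) (specialUnitaryUnits (Fin N)) R₁ R₂ (f j)) (fun U => U) (parT (f j).toKIdx) (GpY (f j).toKIdx (parT (f j).toKIdx)) U) :=
    isTransposePair_smul (isTransposePair_coordOpK_of_isSymmTr (trBasis N) (trBasis_repr_eq_trace N) _ (hsymRT (f j) hM1x α₀ hα ha U hU)) _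
  have hPeq : PcoK (f j).toKIdx (trBasis N) (bg9YR (Matrix (Fin N) (Fin N) ℂ) (specialUnitaryUnits (Fin N)) R₁ R₂ (f j)) (fun U => U) (parT (f j).toKIdx)
      (GpY (f j).toKIdx (parT (f j).toKIdx)) U = 1 - (cR39 (trBasis N)) •
        RcoK (f j).toKIdx (trBasis N) (bg9YR (Matrix (Fin N) (Fin N) ℂ) (specialUnitaryUnits (Fin N)) R₁ R₂ (f j)) (fun U => U) (parT (f j).toKIdx) (GpY (f j).toKIdx (parT (f j).toKIdx)) U := by
    rw [rcoK_eq, smul_smul, mul_inv_cancel₀ hc0.ne', one_smul, Module.End.one_eq_id, sub_sub_cancel]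
  have hPT : IsTransposePair
      (PcoK (f j).toKIdx (trBasis N) (bg9YR (Matrix (Fin N) (Fin N) ℂ) (specialUnitaryUnits (Fin N)) R₁ R₂ (f j)) (fun U => U) (parT (f j).toKIdx) (GpY (f j).toKIdx (parT (f j).toKIdx)) U)
      (PcoK (f j).toKIdx (trBasis N) (bg9YR (Matrix (Fin N) (Fin N) ℂ) (specialUnitaryUnits (Fin N)) R₁ R₂ (f j)) (fun U => U) (parT (f j).toKIdx) (GpY (f j).toKIdx (parT (f j).toKIdx)) U) := by
    rw [hPeq]; exact isTransposePair_one.sub (isTransposePair_smul hRsym _)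
  have hI := h152 j hM1x α₀ hα ha U hU hU'
  have hB₅le : |((f j).toKIdx.cf * etaS (f j).toKIdx) ^ 2| * ((Fintype.card (Fin (d + 1)) : ℝ) * (1 * ((Fintype.card (Fin (d + 1)) : ℝ) *
      (((d : ℝ) + 1) * (CA * CE * c) * c)) * c)) ≤ B₅ := by
    rw [hcf, one_pow, hcard]
  refine ⟨?_, fun μ₀ => ?_⟩
  · -- rgdDs: E = ∇*_U; the word G′∘D*∘∇*_U decomposed at the letters
    have hX : BlockBd (g := toB6 (geo9Y (f j)) 1 (H (f j))) (𝔬12 (f j)).blkY (𝔬12 (f j)).blkW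
        (GcoS (f j).toKIdx (trBasis N) (bg9YR (Matrix (Fin N) (Fin N) ℂ) (specialUnitaryUnits (Fin N)) R₁ R₂ (f j)) (fun U => U) (O (f j)) U ∘ₗ (𝔬12 (f j)).Dvstar U ∘ₗ (𝔬12 (f j)).Dstar U)
        (fun (a b : (geo9Y (f j)).Site) => B₅ * Real.exp (-(δ₃ * (geo9Y (f j)).dist a b))) := by
      rw [hblkY12 (f j), hblkW12 (f j), hDvsco12 (f j) U, hDsco12 (f j) U]
      exact blockBd_slotWord hG hrowx (GcoS_DvscoKH_DscoK_eq (f j).toKIdx (trBasis N) (bg9YR (Matrix (Fin N) (Fin N) ℂ) (specialUnitaryUnits (Fin N)) R₁ R₂ (f j)) (fun U => U) (O (f j)) U)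
        hA hE hCp hPr hCA hCE (by positivity) zero_le_one hc hδ₃0 hδ₃5 le_rfl hB₅le
    exact rgdE_of_ids3152 (P := fun U => PcoK (f j).toKIdx (trBasis N) (bg9YR (Matrix (Fin N) (Fin N) ℂ) (specialUnitaryUnits (Fin N)) R₁ R₂ (f j)) (fun U => U) (parT (f j).toKIdx)
      (GpY (f j).toKIdx (parT (f j).toKIdx)) U) hG hrowx h49p hR hI hPT hX hϱ hCP hB₅ hδ₃0 le_rfl hδ₃P hB₄b
  · -- rgdDd μ₀: E = ∇*_{U,μ₀} on bond functions
    have hX : BlockBd (g := toB6 (geo9Y (f j)) 1 (H (f j))) (𝔬12 (f j)).blk (𝔬12 (f j)).blkW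
        (GcoS (f j).toKIdx (trBasis N) (bg9YR (Matrix (Fin N) (Fin N) ℂ) (specialUnitaryUnits (Fin N)) R₁ R₂ (f j)) (fun U => U) (O (f j)) U ∘ₗ (𝔬12 (f j)).Dvstar U ∘ₗ DdsA (f j) U μ₀)
        (fun (a b : (geo9Y (f j)).Site) => B₅ * Real.exp (-(δ₃ * (geo9Y (f j)).dist a b))) := by
      rw [hblk12 (f j), hblkW12 (f j), hDvsco12 (f j) U, hDdsA (f j) U]
      exact blockBd_slotWord hG hrowx (GcoS_DvscoKH_DdsB_eq (f j).toKIdx (trBasis N) (bg9YR (Matrix (Fin N) (Fin N) ℂ) (specialUnitaryUnits (Fin N)) R₁ R₂ (f j)) (fun U => U) (O (f j)) U μ₀)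
        (fun μ _ => hA μ μ₀) hE hCp hPr hCA hCE (by positivity) zero_le_one hc hδ₃0 hδ₃5 le_rfl hB₅le
    exact rgdE_of_ids3152 (P := fun U => PcoK (f j).toKIdx (trBasis N) (bg9YR (Matrix (Fin N) (Fin N) ℂ) (specialUnitaryUnits (Fin N)) R₁ R₂ (f j)) (fun U => U) (parT (f j).toKIdx)
      (GpY (f j).toKIdx (parT (f j).toKIdx)) U) hG hrowx h49p hR hI hPT hX hϱ hCP hB₅ hδ₃0 le_rfl hδ₃P hB₄b

end Summit.QuantumFields.YangMills.BalabanUVNodes.N06RgdDsLegAtPinsPhysRParJ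

end
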